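import Summits.QuantumFields.YangMills.Theorems.BalabanUVNodesN11SupplyChainAtCRLetteredNumerics
import Summits.QuantumFields.YangMills.Theorems.BalabanUVNodesN11K0DoorAtCRLetteredNumerics

/-!
# DAG node N11 — ★★★★★ AT THE cR-LETTERED MEMBER `c ∈ [2, 8]` OF K1's WITNESS NUMERICS: K0⁷'s DOOR AND N11's K0-ROWS ROAD TOGETHER — N11's token
# `SupplyChainAt (gaussPinH θᴴ_c) p`, THEOREM 1 OF [III] and the theorem of p. 245 in law form, per windowed run, from dag-n24-c Part 14 §0c's K0-side inputs
# VERBATIM + the run guard + K0's per-cube solvability + [III] §3's supplier — the first parameter of the tree at which the K0-rows road has NO open θ-level letter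

HEADER — WORK-UNIT METADATA.  Cell `pub-ymgap`, YM-PLAN Track A (HUMAN RULING D-0062 ∕ D-0149 width seats), seat `pub-ymgap-dag-n11-w3` (g4; WIDTH SEAT 3∕4 on NODE n11 [B14]),
route `BalabanUVNodes` rev 27, deciding item K1⁸ `StabilityBRunRowsAtRecordR13SepCoPH` = stmt-QuantumFields-26907 (helper lane `--kind proof --supports 26907 --as helper`,
count-neutral).  CAPSTONE of this seat's CLAIM-1 `…N11SupplyChainAtCRLetteredNumerics` (N11's token at the member from the key + guard + solvability + supplier; `c`-blind
rows `rfl`) and CLAIM-2 `…N11K0DoorAtCRLetteredNumerics` (the key — K0⁷'s door `Provisos₁₃SepCoPH` at the history-blind door over the cured member — from Part 14 §0c's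
hypotheses verbatim + `0 < c ≤ 8`).  [III] = [Balaban1988Convergent], [15] = [Balaban1985Variational], [B7] = [Balaban1985Averaging], [I] = [Balaban1987RG1], [IV] = [Balaban1989LargeFieldI].

WHY THIS FILE (dag-n11-d g14 LOCATED-cR, pub-ymgap INBOX I.30035: «the ONE witness-level blocker of N11's no-expansion half: `cR = 1` at every witness of record; ASK: re-pin
`cR ≥ 2`»).  CLAIM-1 ∘ CLAIM-2: at `θᴴ_c := Stage13HParams.ofHistoryBlind F N ⟨θ_c, ZrOfRecord₁₃ F N θ_c⟩`, `θ_c` the all-numerics witness at `{θ₁₅ᶜᶜᴹᵂ(j; γ)'s numerics with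
s2.cR := c}`, `2 ≤ c ≤ 8`, `1 ≤ j`, `γ` in the explicit window of p608030, the K0-rows road's per-run endpoint holds from EXACTLY: Part 14 §0c's K0-side sentences ((8), the R (9)-step
at `(L^j, c₁₅)`, the sign-free windowed β-box of `betaOfRecord₁₃ F N θ₁₅ᶜᶜᴹᵂ` with its two letters, the signs) — the SAME hypotheses under which dag-n24-c closes K1 at `θ₁₅ᶜᶜᴹᵂ` modulo
its `hP` — plus, per windowed run, the run guard `PartCompat₁₃` (a floor on `g_K`, dag-n11-w4), K0's per-cube [15]-solvability (the SAME row as at `θ₁₅ᶜᶜᴹᵂ`, `rfl`) and a [III] §3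
supplier with `SupplierObligations ∧ SupplierBorel`.  No `2 ≤ 1`, no open numeric letter, no cover letter: LOCATED-cR is dissolved at this member WITHOUT a definers' file.

WHAT THIS FILE PROVES (0 `def`, 0 `sorry`, standard axioms).
(`e^{−1} ≤ ½` — `Literature.NumberTheory.LFunctions.VinogradovZetaSum.exp_neg_one_le_half`, here read off Mathlib's `Real.exp_neg_one_lt_d9` to keep the imports local — puts the four γ-conditions' `γ` in K0's window `]0, ½]`.)
§1 ★★★★★ `supplyChainAt_gaussPinH_door_ccmwCR_of_betaBoxSignFree_of_solvable` (per run) · ★★★★★ `thmP245Laws_gaussPinH_door_ccmwCR_of_betaBoxSignFree_of_solvable` (Theorem 1 of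
   [III] `∀ k ≤ K, SLaw₁₃CoPH` and `∀ k < K, SLaw → TLaw` per run) · ★★★★★ `exists_window_supplyChainAt_gaussPinH_door_ccmwCR` («γ sufficiently small» QUANTIFIED: ∃ γ₁₁ⁿᵘᵐ(L, j, N) > 0 …).

HONEST FRAMING ∕ A6.  Helper lane, count-neutral; TWO applications by name; nothing of Bałaban asserted: (8), the (9)-step, the β-box (K0⁷'s stub territory), K0's per-cube
solvability ([15] Thm 1's existence half), the run guard and the supplier ([III] §3, (S-α)∕(S-β)) are DISPLAYED HYPOTHESES — every one of them ALSO displayed, verbatim, on the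
`θ₁₅ᶜᶜᴹᵂ` roads of record (Part 14, dag-n11-w1 A–E, dag-n11-e §3c); what is NEW is only that NO θ-level numeric∕regularity∕cover letter remains and `cR = c ≥ 2` HOLDS.  NOT a re-pin
of any witness (no `def`); NOT a discharge; K0⁷ NOT closed; N11 NOT discharged; K1⁸ NOT closed, no stub touched; counts unmoved (typed 28∕28 · discharged 5∕27 · A 5∕28).  One finite
`𝕋⁴_{L^K}` programme at fixed `ε = L^{−K}`; `route-QuantumFields-BalabanUVNodes` closes ONLY the CONDITIONAL finite-𝕋⁴ rung `BalabanLadder.UV` — NOT ℝ⁴, NOT OS, NOT the Yang–Mills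
mass gap (Clay).  No `sorry`, no `axiom`, no `def`, no `instance`, no `notation`.
Sources (SHAPE only): [III] Theorem p.245, Thm 1 p.262, §3 p.279, (2.4)–(2.8) pp.255–256, (2.10) p.256, (2.16)–(2.18) p.257, (2.28) p.259, (3.16)–(3.25) pp.268–270; [15] Thm 1 (7)–(9)
pp.278–279, (144)–(152) pp.300–301; [B7] Prop. 2 p.26; [I] Thm 1 p.259, (0.20) p.256, (1.20)–(1.22) p.264; [IV] (0.2)–(0.4) p.176.
-/

noncomputable section

open MeasureTheory
open scoped BigOperators ENNReal NNReal Matrix.Norms.L2Operator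

namespace Summit.QuantumFields.YangMills.Theorems.BalabanUVNodesN11SupplyChainAtCRLetteredDoor

open Literature.MathematicalPhysics.QuantumFieldTheory.Balaban1983to89 T4Continuum T4NestedCovariance Node00 Node00.Tk DagBinding
open B15DeterminingSets B8Eq17ClassAkV1 B14.Eq218Concrete B10Eq42TorusConstraint FlowStep
open B14.Eq213MaximalDomains (side)
open B14.Eq213DetSet (Bj)
open Literature.MathematicalPhysics.QuantumFieldTheory.BalabanImbrieJaffe1984to88.BIJ85Eq453GaugeField (qsstarGIter0)
open BalabanUVNodesN11GaussianCertificateDefs (gaussPinH)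
open BalabanUVNodesN11Sect3SupplyChainDefs
open BalabanUVNodesN11Sect3SupplyChainBorelB
open BalabanUVNodesN11Sect3SupplyChainObligationsDefs
open BalabanUVNodesN11NoExpansionNumericsAtThm1CCMW (exists_window_ccmShape)
open BalabanUVNodesN11SupplyChainAtCRLetteredNumerics
open BalabanUVNodesN11K0DoorAtCRLetteredNumerics

/-! ## §1  ★★★★★ The K0-rows road at the member's door: key by CLAIM-2, letters by CLAIM-1 -/

section Capstone

variable {F : T4Family} {N : ℕ} [NeZero N] {j c₁₅ : ℕ} {γ c ε₀ ε₂₉ B₃ B₃' a₀ a₁ : ℝ} {θ : Stage13Params F N}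

/-- **★★★★★ N11's TOKEN ON THE K0-ROWS ROAD AT THE GAUSSIAN CERTIFICATE OVER THE MEMBER's HISTORY-BLIND DOOR, PER WINDOWED RUN, FROM PART 14 §0c's K0-SIDE INPUTS VERBATIM +
THE RUN GUARD + K0's SOLVABILITY + THE SUPPLIER** (`2 ≤ c ≤ 8`, `1 ≤ j`, the four γ-conditions, the signs): CLAIM-1's ★★★ with its key `h` SUPPLIED by CLAIM-2's ★★★★ door.
[cite: Balaban1988Convergent, Thm 1 p.262, Theorem p.245, §3 p.279, (2.4)–(2.8) pp.255–256, (2.10) p.256, (2.16)–(2.17) p.257, (3.24)–(3.25) p.270; Balaban1985Variational, (7) p.278, Thm 1 (8)–(9) p.279, (152) p.301; Balaban1985Averaging, Prop. 2 p.26; Balaban1987RG1, Thm 1 p.259, (0.20) p.256, (1.20)–(1.22) p.264; Balaban1989LargeFieldI, (0.2)–(0.4) p.176] -/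
theorem supplyChainAt_gaussPinH_door_ccmwCR_of_betaBoxSignFree_of_solvable (hθ : θ = theta13LiveOfNumerics F N
      ({ stage12NumericsOfThm1CCMW F.L j γ ε₀ B₃ B₃' a₀ a₁ with s2 := { sect2NumericsOfThm1C F.L with cR := c } } : Stage12Numerics) ε₂₉
      (zeta316OfRecord F N (stage12NumericsOfThm1CCMW F.L j γ ε₀ B₃ B₃' a₀ a₁).ν (stage12NumericsOfThm1CCMW F.L j γ ε₀ B₃ B₃' a₀ a₁).τ9.M
        (stage12NumericsOfThm1CCMW F.L j γ ε₀ B₃ B₃' a₀ a₁).A₁) (RzOfRecord F N) (ZtOfRecord F N))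
    (hc2 : 2 ≤ c) (hc8 : c ≤ 8) (hj : 1 ≤ j) (hε : 0 < ε₀) (hε' : 0 < ε₂₉) (hB : 0 ≤ B₃) (hB' : 0 ≤ B₃') (ha₀ : 0 < a₀) (ha₁ : 0 < a₁)
    (hγ0 : 0 < γ) (hγe : γ ≤ Real.exp (-1))
    (h3γ : 3 * (F.L : ℝ) ^ j ≤ F.L * Real.log (γ ^ 2)⁻¹) (hRγ : ((8 * F.L + 3 : ℕ) : ℝ) ≤ F.L * Real.log (γ ^ 2)⁻¹)
    (hε3γ : 36608 * (γ * Real.log (γ ^ 2)⁻¹) ≤ 16 / 3) (hε2γ : γ * Real.log (γ ^ 2)⁻¹ ≤ 16 * ExpMeanLog.deltaSU (Fin N) / ((8 * F.L : ℕ) : ℝ) ^ 2)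
    (h15 : VariationalThm1RegSepCoP7M F N B₃ a₀ a₁) (hc₁₅ : c₁₅ ≤ F.L ^ j)
    (h9 : Gauge9RegSepTopStepR F N (fun ν K Ω => suppDomOfRecord F ν K Ω) (F.L ^ j) c₁₅ B₃ B₃' a₀ a₁)
    {bl β' : ℝ} (hbox : BetaLowerH bl γ (betaOfRecord₁₃ F N (theta13OfThm1CCMW F N j γ ε₀ ε₂₉ B₃ B₃' a₀ a₁)))
    (hbox' : BetaUpperH β' γ (betaOfRecord₁₃ F N (theta13OfThm1CCMW F N j γ ε₀ ε₂₉ B₃ B₃' a₀ a₁))) (hl : -bl * γ ^ 2 ≤ 3) (hβ' : β' * γ ^ 2 ≤ 3 / 4)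
    (p : B12.RunParams) (hw : Step.InInterval γ p.K (gOfRecord₁₃ F N θ p)) (hPC : PartCompat₁₃ F N θ p p.K)
    (hsolv : ∀ i, 1 ≤ i → i ≤ p.K → ∀ (s : SeqOfRecord F θ.ν θ.τ9.M (gOfRecord₁₃ F N θ p) p.K i) (V : GaugeField (F.P p.K) i (SU N)),
      chiSeqOfRecord F N θ.ν θ.τ9.M (gOfRecord₁₃ F N θ p) p.K i s V ≠ 0 →
      ∀ a ∈ cubesIn (fun a : ↥(cubeIndices (F.P p.K) (cubeSide (F.P p.K).L θ.ν.M₂ (RkOfRecord (F.P p.K).L θ.ν.r (gOfRecord₁₃ F N θ p i)) i)) =>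
          cubeEnl (F.P p.K) (cubeSide (F.P p.K).L θ.ν.M₂ (RkOfRecord (F.P p.K).L θ.ν.r (gOfRecord₁₃ F N θ p i)) i) a 0) (s.Ω i),
        ∃ U₀, IsMinimizer (avOfRecord F N p.K) {U | PlaqSmall (θ.ν.εreg * (F.P p.K).eta i ^ 2) U}
          (Bj θ.ν.M₁ (cubeEnl (F.P p.K) (cubeSide (F.P p.K).L θ.ν.M₂ (RkOfRecord (F.P p.K).L θ.ν.r (gOfRecord₁₃ F N θ p i)) i) a 4) i)
          (avgFamily (avOfRecord F N p.K) (qsstarGIter0 i V)) U₀)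
    (σ : Sect3Supplier (gaussPinH (Stage13HParams.ofHistoryBlind F N ⟨θ, ZrOfRecord₁₃ F N θ⟩)) p) (hσ : SupplierObligations (gaussPinH (Stage13HParams.ofHistoryBlind F N ⟨θ, ZrOfRecord₁₃ F N θ⟩)) p σ)
    (hσB : SupplierBorel (gaussPinH (Stage13HParams.ofHistoryBlind F N ⟨θ, ZrOfRecord₁₃ F N θ⟩)) p σ) :
    SupplyChainAt (gaussPinH (Stage13HParams.ofHistoryBlind F N ⟨θ, ZrOfRecord₁₃ F N θ⟩)) p :=
  have hkey := provisos₁₃SepCoPH_door_ccmwCR_of_gauge9TopStepR_of_betaBoxSignFree_allTorus hθ (by linarith) hc8 hγ0 (hγe.trans (Real.exp_neg_one_lt_d9.le.trans (by norm_num))) hε hε' hB hB' ha₀ ha₁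
    h15 hc₁₅ h9 hbox hbox' hl hβ'
  supplyChainAt_gaussPinH_of_ccmwCRH_of_supplierBorel_of_solvable (θ := (Stage13HParams.ofHistoryBlind F N ⟨θ, ZrOfRecord₁₃ F N θ⟩))
    (ζ := zeta316OfRecord F N (stage12NumericsOfThm1CCMW F.L j γ ε₀ B₃ B₃' a₀ a₁).ν (stage12NumericsOfThm1CCMW F.L j γ ε₀ B₃ B₃' a₀ a₁).τ9.M
      (stage12NumericsOfThm1CCMW F.L j γ ε₀ B₃ B₃' a₀ a₁).A₁) (Rz := RzOfRecord F N) (Zt := ZtOfRecord F N)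
    (by subst hθ; rfl) hc2 hj hε hε' hB hB' ha₀ ha₁ hγ0 hγe h3γ hRγ hε3γ hε2γ hkey p hw hPC hsolv σ hσ hσB

/-- **★★★★★ THEOREM 1 OF [III] ALONG THE RUN AND THE THEOREM OF p. 245 IN LAW FORM AT THE GAUSSIAN CERTIFICATE OVER THE MEMBER's DOOR, PER WINDOWED RUN, FROM PART 14 §0c's
K0-SIDE INPUTS VERBATIM + THE RUN GUARD + K0's SOLVABILITY + THE SUPPLIER** (CLAIM-1's ★★★ laws face with its key SUPPLIED by CLAIM-2's door).
[cite: Balaban1988Convergent, Thm 1 p.262, Theorem p.245, remark p.262, §3 p.279, (3.24)–(3.25) p.270, (2.10) p.256; Balaban1985Variational, Thm 1 (8)–(9) p.279; Balaban1987RG1, Thm 1 p.259; Balaban1989LargeFieldI, (0.3)–(0.4) p.176] -/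
theorem thmP245Laws_gaussPinH_door_ccmwCR_of_betaBoxSignFree_of_solvable (hθ : θ = theta13LiveOfNumerics F N
      ({ stage12NumericsOfThm1CCMW F.L j γ ε₀ B₃ B₃' a₀ a₁ with s2 := { sect2NumericsOfThm1C F.L with cR := c } } : Stage12Numerics) ε₂₉
      (zeta316OfRecord F N (stage12NumericsOfThm1CCMW F.L j γ ε₀ B₃ B₃' a₀ a₁).ν (stage12NumericsOfThm1CCMW F.L j γ ε₀ B₃ B₃' a₀ a₁).τ9.M
        (stage12NumericsOfThm1CCMW F.L j γ ε₀ B₃ B₃' a₀ a₁).A₁) (RzOfRecord F N) (ZtOfRecord F N))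
    (hc2 : 2 ≤ c) (hc8 : c ≤ 8) (hj : 1 ≤ j) (hε : 0 < ε₀) (hε' : 0 < ε₂₉) (hB : 0 ≤ B₃) (hB' : 0 ≤ B₃') (ha₀ : 0 < a₀) (ha₁ : 0 < a₁)
    (hγ0 : 0 < γ) (hγe : γ ≤ Real.exp (-1))
    (h3γ : 3 * (F.L : ℝ) ^ j ≤ F.L * Real.log (γ ^ 2)⁻¹) (hRγ : ((8 * F.L + 3 : ℕ) : ℝ) ≤ F.L * Real.log (γ ^ 2)⁻¹)
    (hε3γ : 36608 * (γ * Real.log (γ ^ 2)⁻¹) ≤ 16 / 3) (hε2γ : γ * Real.log (γ ^ 2)⁻¹ ≤ 16 * ExpMeanLog.deltaSU (Fin N) / ((8 * F.L : ℕ) : ℝ) ^ 2)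
    (h15 : VariationalThm1RegSepCoP7M F N B₃ a₀ a₁) (hc₁₅ : c₁₅ ≤ F.L ^ j)
    (h9 : Gauge9RegSepTopStepR F N (fun ν K Ω => suppDomOfRecord F ν K Ω) (F.L ^ j) c₁₅ B₃ B₃' a₀ a₁)
    {bl β' : ℝ} (hbox : BetaLowerH bl γ (betaOfRecord₁₃ F N (theta13OfThm1CCMW F N j γ ε₀ ε₂₉ B₃ B₃' a₀ a₁)))
    (hbox' : BetaUpperH β' γ (betaOfRecord₁₃ F N (theta13OfThm1CCMW F N j γ ε₀ ε₂₉ B₃ B₃' a₀ a₁))) (hl : -bl * γ ^ 2 ≤ 3) (hβ' : β' * γ ^ 2 ≤ 3 / 4)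
    (p : B12.RunParams) (hw : Step.InInterval γ p.K (gOfRecord₁₃ F N θ p)) (hPC : PartCompat₁₃ F N θ p p.K)
    (hsolv : ∀ i, 1 ≤ i → i ≤ p.K → ∀ (s : SeqOfRecord F θ.ν θ.τ9.M (gOfRecord₁₃ F N θ p) p.K i) (V : GaugeField (F.P p.K) i (SU N)),
      chiSeqOfRecord F N θ.ν θ.τ9.M (gOfRecord₁₃ F N θ p) p.K i s V ≠ 0 →
      ∀ a ∈ cubesIn (fun a : ↥(cubeIndices (F.P p.K) (cubeSide (F.P p.K).L θ.ν.M₂ (RkOfRecord (F.P p.K).L θ.ν.r (gOfRecord₁₃ F N θ p i)) i)) =>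
          cubeEnl (F.P p.K) (cubeSide (F.P p.K).L θ.ν.M₂ (RkOfRecord (F.P p.K).L θ.ν.r (gOfRecord₁₃ F N θ p i)) i) a 0) (s.Ω i),
        ∃ U₀, IsMinimizer (avOfRecord F N p.K) {U | PlaqSmall (θ.ν.εreg * (F.P p.K).eta i ^ 2) U}
          (Bj θ.ν.M₁ (cubeEnl (F.P p.K) (cubeSide (F.P p.K).L θ.ν.M₂ (RkOfRecord (F.P p.K).L θ.ν.r (gOfRecord₁₃ F N θ p i)) i) a 4) i)
          (avgFamily (avOfRecord F N p.K) (qsstarGIter0 i V)) U₀)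
    (σ : Sect3Supplier (gaussPinH (Stage13HParams.ofHistoryBlind F N ⟨θ, ZrOfRecord₁₃ F N θ⟩)) p) (hσ : SupplierObligations (gaussPinH (Stage13HParams.ofHistoryBlind F N ⟨θ, ZrOfRecord₁₃ F N θ⟩)) p σ)
    (hσB : SupplierBorel (gaussPinH (Stage13HParams.ofHistoryBlind F N ⟨θ, ZrOfRecord₁₃ F N θ⟩)) p σ) :
    (∀ k, k ≤ p.K → SLaw₁₃CoPH F N (gaussPinH (Stage13HParams.ofHistoryBlind F N ⟨θ, ZrOfRecord₁₃ F N θ⟩)) p k) ∧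
    (∀ k, k < p.K → SLaw₁₃CoPH F N (gaussPinH (Stage13HParams.ofHistoryBlind F N ⟨θ, ZrOfRecord₁₃ F N θ⟩)) p k → TLaw₁₃CoPH F N (gaussPinH (Stage13HParams.ofHistoryBlind F N ⟨θ, ZrOfRecord₁₃ F N θ⟩)) p k) :=
  have hkey := provisos₁₃SepCoPH_door_ccmwCR_of_gauge9TopStepR_of_betaBoxSignFree_allTorus hθ (by linarith) hc8 hγ0 (hγe.trans (Real.exp_neg_one_lt_d9.le.trans (by norm_num))) hε hε' hB hB' ha₀ ha₁
    h15 hc₁₅ h9 hbox hbox' hl hβ'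
  thmP245Laws_gaussPinH_of_ccmwCRH_of_supplierBorel_of_solvable (θ := (Stage13HParams.ofHistoryBlind F N ⟨θ, ZrOfRecord₁₃ F N θ⟩))
    (ζ := zeta316OfRecord F N (stage12NumericsOfThm1CCMW F.L j γ ε₀ B₃ B₃' a₀ a₁).ν (stage12NumericsOfThm1CCMW F.L j γ ε₀ B₃ B₃' a₀ a₁).τ9.M
      (stage12NumericsOfThm1CCMW F.L j γ ε₀ B₃ B₃' a₀ a₁).A₁) (Rz := RzOfRecord F N) (Zt := ZtOfRecord F N)
    (by subst hθ; rfl) hc2 hj hε hε' hB hB' ha₀ ha₁ hγ0 hγe h3γ hRγ hε3γ hε2γ hkey p hw hPC hsolv σ hσ hσB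

end Capstone

/-- **★★★★★ «γ SUFFICIENTLY SMALL» QUANTIFIED AT THE MEMBER's DOOR**: an explicit `γ₁₁ⁿᵘᵐ(L, j, N) > 0` (p608030 §1) such that for every `γ ∈ ]0, γ₁₁ⁿᵘᵐ]`, every `c ∈ [2, 8]`,
Part 14 §0c's K0-side inputs at that `γ` and, per run in the window, the guard + K0's solvability + the supplier give N11's token at the Gaussian certificate over the member's door.
[cite: Balaban1988Convergent, Thm 1 p.262, Theorem p.245, §3 p.279, (2.4)–(2.5) p.255, (2.10) p.256; Balaban1987RG1, Thm 1 p.259; Balaban1985Variational, (7) p.278, Thm 1 (8)–(9) p.279; Balaban1985Averaging, Prop. 2 p.26] -/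
theorem exists_window_supplyChainAt_gaussPinH_door_ccmwCR (F : T4Family) (N : ℕ) [NeZero N] {j : ℕ} (hj : 1 ≤ j) :
    ∃ γ₀ : ℝ, 0 < γ₀ ∧ ∀ (γ c ε₀ ε₂₉ B₃ B₃' a₀ a₁ : ℝ) (c₁₅ : ℕ), 2 ≤ c → c ≤ 8 → 0 < ε₀ → 0 < ε₂₉ → 0 ≤ B₃ → 0 ≤ B₃' → 0 < a₀ → 0 < a₁ → 0 < γ → γ ≤ γ₀ →
      VariationalThm1RegSepCoP7M F N B₃ a₀ a₁ → c₁₅ ≤ F.L ^ j → Gauge9RegSepTopStepR F N (fun ν K Ω => suppDomOfRecord F ν K Ω) (F.L ^ j) c₁₅ B₃ B₃' a₀ a₁ →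
      ∀ (bl β' : ℝ), BetaLowerH bl γ (betaOfRecord₁₃ F N (theta13OfThm1CCMW F N j γ ε₀ ε₂₉ B₃ B₃' a₀ a₁)) →
        BetaUpperH β' γ (betaOfRecord₁₃ F N (theta13OfThm1CCMW F N j γ ε₀ ε₂₉ B₃ B₃' a₀ a₁)) → -bl * γ ^ 2 ≤ 3 → β' * γ ^ 2 ≤ 3 / 4 →
      ∀ (θ : Stage13Params F N), θ = theta13LiveOfNumerics F N
      ({ stage12NumericsOfThm1CCMW F.L j γ ε₀ B₃ B₃' a₀ a₁ with s2 := { sect2NumericsOfThm1C F.L with cR := c } } : Stage12Numerics) ε₂₉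
      (zeta316OfRecord F N (stage12NumericsOfThm1CCMW F.L j γ ε₀ B₃ B₃' a₀ a₁).ν (stage12NumericsOfThm1CCMW F.L j γ ε₀ B₃ B₃' a₀ a₁).τ9.M
        (stage12NumericsOfThm1CCMW F.L j γ ε₀ B₃ B₃' a₀ a₁).A₁) (RzOfRecord F N) (ZtOfRecord F N) →
      ∀ p : B12.RunParams, Step.InInterval γ p.K (gOfRecord₁₃ F N θ p) → PartCompat₁₃ F N θ p p.K →
        (∀ i, 1 ≤ i → i ≤ p.K → ∀ (s : SeqOfRecord F θ.ν θ.τ9.M (gOfRecord₁₃ F N θ p) p.K i) (V : GaugeField (F.P p.K) i (SU N)),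
          chiSeqOfRecord F N θ.ν θ.τ9.M (gOfRecord₁₃ F N θ p) p.K i s V ≠ 0 →
          ∀ a ∈ cubesIn (fun a : ↥(cubeIndices (F.P p.K) (cubeSide (F.P p.K).L θ.ν.M₂ (RkOfRecord (F.P p.K).L θ.ν.r (gOfRecord₁₃ F N θ p i)) i)) =>
              cubeEnl (F.P p.K) (cubeSide (F.P p.K).L θ.ν.M₂ (RkOfRecord (F.P p.K).L θ.ν.r (gOfRecord₁₃ F N θ p i)) i) a 0) (s.Ω i),
            ∃ U₀, IsMinimizer (avOfRecord F N p.K) {U | PlaqSmall (θ.ν.εreg * (F.P p.K).eta i ^ 2) U}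
              (Bj θ.ν.M₁ (cubeEnl (F.P p.K) (cubeSide (F.P p.K).L θ.ν.M₂ (RkOfRecord (F.P p.K).L θ.ν.r (gOfRecord₁₃ F N θ p i)) i) a 4) i)
              (avgFamily (avOfRecord F N p.K) (qsstarGIter0 i V)) U₀) →
        ∀ σ : Sect3Supplier (gaussPinH (Stage13HParams.ofHistoryBlind F N ⟨θ, ZrOfRecord₁₃ F N θ⟩)) p,
          SupplierObligations (gaussPinH (Stage13HParams.ofHistoryBlind F N ⟨θ, ZrOfRecord₁₃ F N θ⟩)) p σ → SupplierBorel (gaussPinH (Stage13HParams.ofHistoryBlind F N ⟨θ, ZrOfRecord₁₃ F N θ⟩)) p σ →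
          SupplyChainAt (gaussPinH (Stage13HParams.ofHistoryBlind F N ⟨θ, ZrOfRecord₁₃ F N θ⟩)) p := by
  obtain ⟨γ₀, hγ₀, hall⟩ := exists_window_ccmShape (L := F.L) (by have := F.hL11; omega) j N
  refine ⟨γ₀, hγ₀, fun γ c ε₀ ε₂₉ B₃ B₃' a₀ a₁ c₁₅ hc2 hc8 hε hε' hB hB' ha₀ ha₁ hγ hγle h15 hc₁₅ h9 bl β' hbox hbox' hl hβ' θ hθ p hw hPC hsolv σ hσ hσB => ?_⟩
  obtain ⟨hγe, h3γ, hRγ, hε3γ, hε2γ⟩ := hall γ hγ hγle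
  exact supplyChainAt_gaussPinH_door_ccmwCR_of_betaBoxSignFree_of_solvable hθ hc2 hc8 hj hε hε' hB hB' ha₀ ha₁ hγ hγe h3γ hRγ hε3γ hε2γ h15 hc₁₅ h9 hbox hbox' hl hβ'
    p hw hPC hsolv σ hσ hσB

end Summit.QuantumFields.YangMills.Theorems.BalabanUVNodesN11SupplyChainAtCRLetteredDoor

end
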